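import Literature.NumberTheory.Automorphic.UnitaryRegularOrbitalIntegralLocallyConstant
import Mathlib.Topology.Separation.Profinite
import HarnessLib

/-!
# The Cayley chart of a unitary group `U(σ, J)` AS A CHART DATUM: an `OpenPartialHomeomorph` into `U`, with the regular, saturated and
# STABLY SEPARATED compact-open boxes (N6ns-reg-(iv), CM dress — FILE 1, field level)

Topic `NumberTheory/Automorphic`; namespace `Literature.NumberTheory.Automorphic`. THEOREMS ONLY (no definition, no instance, no notation, no named
fact, no `sorry`). Cell `pub/hodgecm-mathlib`, programme P3a, road «N6-ns», brick **N6ns-reg-(iv) CM DRESS** (LEAD F0P3a-plan (g9) T8-19 (D)(3)), FILE 1 of 2: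
the FIELD-level chart datum that F0P3a-p08's generic realisation layer ★ `OrbitalIntegralChartRealisation`
(`OrbitalMeasureFamily.IsCanonical.exists_isLocSmooth_classOrbitalIntegral_mk_eq_of_chart`) reads — binders `e s τ he hKB hreg hsat` — for a unitary group,
plus the separation (SEP) of torus points under AMBIENT `GL_n` conjugacy (= stable conjugacy, ★ `Rogawski1990.isStablyConj_iff`) that feeds its (iv-c).

SETTING (that of F0P3a-p03's ★ `UnitaryRegularOrbitalIntegralLocallyConstant`, imported, never restated): `E` a complete non-trivially normed field,
`σ : E →+* E` continuous, `J ∈ M_n(E)` with unit determinant, `U = U(σ, J) ≤ GL_n(E)` (★ `unitaryGroupOfForm`), `γ ∈ U` with separable characteristic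
polynomial, `ad = L_γ − R_γ`, `θ X = J⁻¹ σ(X)ᵀ J`, `c` the Cayley map (★ `cayley`). CARRIERS (concrete subtypes, no definition):
`A = {X ∈ range ad | θ X = −X, ‖X‖ < 1}`, `B = {Y ∈ ker ad | θ Y = −Y, ‖Y‖ < 1}` — inside the unit ball `1 ± X` are units, so the slice `s(X) = c(X) ∈ U` and the
torus coordinate `τ(Y) = γ c(Y) ∈ Z_U(γ)` are TOTAL continuous maps (★ `continuous_cayleyUnit`, ★ `cayley_mem_unitaryGroupOfForm`, ★ `commute_cayley`).

* §1 `exists_box_of_chartDatum` — GENERIC over a subgroup `U ≤ GL_n(E)` of a `T₁` topological field and an ABSTRACT chart datum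
  `(e : OpenPartialHomeomorph (A × B) U, s, τ)` with `e = s·τ·s⁻¹` on its source, `s a₀ = 1`, `τ b₀ = γ` regular semisimple, `τ(B) ⊆ Z_U(γ)`, and compact-open
  neighbourhood bases at `a₀`, `b₀`: inside ANY neighbourhood of `(a₀, b₀)` there are compact open `K ∋ a₀`, `B₁ ∋ b₀` with `K × B₁ ⊆ e.source` and
  (reg) `χ(τ b)` separable, `Z_U(τ b) = Z_U(γ)` (★ `Subgroup.isOpen_setOf_charpoly_separable`, ★ `centralizer_eq_centralizer_of_charpoly_separable`);
  (SAT) `x τ(b) x⁻¹ ∈ e(K × B₁) ⇒ x ∈ s(K)·Z_U(γ)` (★ `exists_nhds_forall_conj_eq_imp_mem_centralizer` + ★ `mem_mul_of_conj_mem_image_chart`);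
  (SEP) `τ b ∼ τ b′` in the AMBIENT `GL_n(E)` ⇒ `b = b′` (★ `eventually_mem_centralizer_of_conj_eq` — near `(γ, γ)` two `GL`-conjugate points of `Z(γ)`
  COINCIDE — and `e.injOn`: `e(a₀, b) = τ b`).
* §2 `exists_openPartialHomeomorph_unitary_cayleyChart` — A-p16 (g25)'s chart ★ `exists_openPartialHomeomorph_cayleyConj_isImage_unitary`
  (`e₃ : 𝔪 × 𝔠 → M_n(E)` with `e₃.IsImage {θ-skew} {unitary}`) RESTRICTED to an `OpenPartialHomeomorph (A × B) U` whose forward map is LITERALLY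
  `(a, b) ↦ s(a) τ(b) s(a)⁻¹` (built inside the proof; Mathlib's `IsImage.restr` wants an open `s`, the θ-skew set is a closed subspace).
* §3 `exists_isCompact_isOpen_nhds_skewBall` — for `E` proper and totally disconnected, `A` and `B` have compact-open neighbourhood bases at `0`
  (clopen basis of the locally compact totally disconnected `M_n(E)`, Mathlib `loc_compact_Haus_tot_disc_of_zero_dim`, cut back to the closed θ-skew part).
* §4 **`exists_unitary_cayleyChartDatum`** — the assembled head: `∃ s τ e a₀ b₀` with the formulas, continuity, `τ b₀ = γ`, `(a₀, b₀) ∈ e.source`,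
  `e = s·τ·s⁻¹` EVERYWHERE, and the box clause (reg) ∧ (SAT) ∧ (SEP) inside every neighbourhood of `(a₀, b₀)`.

HONEST SCOPE. Point-set topology and linear algebra; no measure. The CM instantiation (`(cmDatum L 2 Φ₂).Local v × (cmDatum L 1 Φ₁).Local v` at a
non-split place, `IsLocalStablyConjH`) is FILE 2. HC_CM is proved only modulo the printed citations until rung 0 closes; this file discharges no printed
statement.

## References
* [HarishChandra1970] Harish-Chandra (notes by G. van Dijk), *Harmonic Analysis on Reductive p-adic Groups*, LNM 162 (1970), Part I §3 (local product
  structure of regular orbits; the submersion `G × T′ → G`).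
* [Rogawski1990] J. D. Rogawski, *Automorphic Representations of Unitary Groups in Three Variables*, Ann. of Math. Stud. 123 (1990), §3.1 p. 19
  (stable conjugacy = `GL_n`-conjugacy), §4.3 p. 43, §4.9 p. 54.
* [Weyl1939] H. Weyl, *The Classical Groups* (1939), Ch. II §10 (Cayley parametrisation).
-/

set_option autoImplicit false

noncomputable section

open Set Filter Topology Polynomial
open Literature.Analysis.Calculus Literature.LinearAlgebra.Matrix
open scoped Matrix.Norms.Operator Matrix MatrixGroups Pointwise

namespace Literature.NumberTheory.Automorphic

/-! ## §0 Compact open neighbourhoods in a locally compact Hausdorff totally disconnected space -/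

/-- Every neighbourhood of a point of a locally compact Hausdorff totally disconnected space contains a COMPACT OPEN neighbourhood of the point
(clopen basis, Mathlib `loc_compact_Haus_tot_disc_of_zero_dim`, inside a compact neighbourhood). [folklore] -/
private theorem exists_isCompact_isOpen_mem_subset_of_mem_nhds {X : Type*} [TopologicalSpace X] [LocallyCompactSpace X] [T2Space X]
    [TotallyDisconnectedSpace X] {x : X} {N : Set X} (hN : N ∈ 𝓝 x) :
    ∃ V : Set X, IsCompact V ∧ IsOpen V ∧ x ∈ V ∧ V ⊆ N := by
  obtain ⟨L, hLc, hLx⟩ := WeaklyLocallyCompactSpace.exists_compact_mem_nhds x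
  have hx' : x ∈ interior (L ∩ N) := mem_interior_iff_mem_nhds.2 (inter_mem hLx hN)
  obtain ⟨C, hCclopen, hxC, hCsub⟩ :=
    (loc_compact_Haus_tot_disc_of_zero_dim (H := X)).exists_subset_of_mem_open hx' isOpen_interior
  exact ⟨C, hLc.of_isClosed_subset hCclopen.1 (hCsub.trans (interior_subset.trans inter_subset_left)), hCclopen.2, hxC,
    hCsub.trans (interior_subset.trans inter_subset_right)⟩

/-! ## §1 GENERIC: an abstract chart datum on a subgroup `U ≤ GL_n(E)` ⇒ regular, saturated, stably separated compact-open boxes -/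

section Subgroup

variable {E : Type*} [Field E] [TopologicalSpace E] [IsTopologicalRing E] [T1Space E]
  {n : Type*} [Fintype n] [DecidableEq n] {U : Subgroup (GL n E)}
  {A B : Type*} [TopologicalSpace A] [TopologicalSpace B]

/-- **The box clause for an abstract chart datum.** `U ≤ GL_n(E)`, `γ ∈ U` regular semisimple, `e : A × B → U` an open partial homeomorphism equal to
`(a, b) ↦ s(a) τ(b) s(a)⁻¹` on its source, `τ b₀ = γ`, `τ` continuous with values in `Z_U(γ)`, and compact-open neighbourhood bases at `a₀` and `b₀`.
Then every neighbourhood of `(a₀, b₀)` contains a compact-open box `K × B₁ ⊆ e.source` on which: (reg) `χ(τ b)` is separable and `Z_U(τ b) = Z_U(γ)`;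
(SAT) `x τ(b) x⁻¹ ∈ e(K × B₁) ⇒ x ∈ s(K) · Z_U(γ)`; (SEP) `τ b`, `τ b′` conjugate in the AMBIENT `GL_n(E)` ⇒ `b = b′` (`e(a₀, b) = s(a₀) τ(b) s(a₀)⁻¹` and `e` is injective on its source).
[cite: HarishChandra1970, Part I §3] [cite: Rogawski1990, §3.1 p. 19; §4.3 p. 43] -/
theorem exists_box_of_chartDatum {γ : ↥U} (hγ : ((γ : GL n E) : Matrix n n E).charpoly.Separable)
    (s : A → ↥U) (τ : B → ↥U) (hτ : Continuous τ) (e : OpenPartialHomeomorph (A × B) ↥U)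
    (he : ∀ p ∈ e.source, e p = s p.1 * τ p.2 * (s p.1)⁻¹) {a₀ : A} {b₀ : B} (h₀ : (a₀, b₀) ∈ e.source)
    (hτ₀ : τ b₀ = γ) (hcomm : ∀ b, τ b ∈ Subgroup.centralizer ({γ} : Set ↥U))
    (hA : ∀ N ∈ 𝓝 a₀, ∃ K : Set A, IsCompact K ∧ IsOpen K ∧ a₀ ∈ K ∧ K ⊆ N)
    (hB : ∀ N ∈ 𝓝 b₀, ∃ K : Set B, IsCompact K ∧ IsOpen K ∧ b₀ ∈ K ∧ K ⊆ N) :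
    ∀ N ∈ 𝓝 (a₀, b₀), ∃ (K : Set A) (B₁ : Set B), IsCompact K ∧ IsOpen K ∧ a₀ ∈ K ∧ IsCompact B₁ ∧ IsOpen B₁ ∧ b₀ ∈ B₁ ∧
      K ×ˢ B₁ ⊆ N ∧ K ×ˢ B₁ ⊆ e.source ∧
      (∀ b ∈ B₁, (((τ b : ↥U) : GL n E) : Matrix n n E).charpoly.Separable ∧
        Subgroup.centralizer ({τ b} : Set ↥U) = Subgroup.centralizer ({γ} : Set ↥U)) ∧
      (∀ b ∈ B₁, ∀ x : ↥U, x * τ b * x⁻¹ ∈ e '' (K ×ˢ B₁) →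
        x ∈ s '' K * (Subgroup.centralizer ({γ} : Set ↥U) : Set ↥U)) ∧
      (∀ b ∈ B₁, ∀ b' ∈ B₁, IsConj ((τ b : ↥U) : GL n E) ((τ b' : ↥U) : GL n E) → b = b') := by
  intro N hN
  -- (1) the regular locus pulled back along `τ`
  have hW₂ : τ ⁻¹' {u : ↥U | ((u : GL n E) : Matrix n n E).charpoly.Separable} ∈ 𝓝 b₀ := by
    refine hτ.continuousAt.preimage_mem_nhds ((U.isOpen_setOf_charpoly_separable).mem_nhds ?_)
    show (((τ b₀ : ↥U) : GL n E) : Matrix n n E).charpoly.Separable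
    rw [hτ₀]
    exact hγ
  -- (2) the Weyl-separated box in `U`
  obtain ⟨W₁, hW₁, hsepW⟩ := exists_nhds_forall_conj_eq_imp_mem_centralizer (U := U) hγ τ hτ.continuousAt hτ₀
  -- (3) the rigidity box in the AMBIENT `GL_n(E)`
  have hq : Tendsto (fun q : B × B => (((τ q.1 : ↥U) : GL n E), ((τ q.2 : ↥U) : GL n E))) (𝓝 (b₀, b₀))
      (𝓝 ((γ : GL n E), (γ : GL n E))) := by
    have h1 : ContinuousAt (fun b : B => ((τ b : ↥U) : GL n E)) b₀ := continuous_subtype_val.continuousAt.comp hτ.continuousAt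
    have h2 := (h1.comp continuous_fst.continuousAt).prodMk (h1.comp continuous_snd.continuousAt) (x := (b₀, b₀))
    simpa only [ContinuousAt, Function.comp_def, hτ₀, nhds_prod_eq] using h2
  have hev := hq.eventually (Literature.LinearAlgebra.Matrix.eventually_mem_centralizer_of_conj_eq (γ : GL n E) hγ)
  obtain ⟨W₃, hW₃, W₄, hW₄, hW₃₄⟩ := mem_nhds_prod_iff.1 hev
  -- (4) the prescribed neighbourhood, cut into a product inside `e.source`
  have hNs : N ∩ e.source ∈ 𝓝 (a₀, b₀) := inter_mem hN (e.open_source.mem_nhds h₀)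
  obtain ⟨NA, hNA, NB, hNB, hNAB⟩ := mem_nhds_prod_iff.1 hNs
  obtain ⟨K, hKc, hKo, haK, hKN⟩ := hA NA hNA
  obtain ⟨B₁, hB₁c, hB₁o, hbB, hB₁N⟩ := hB (((NB ∩ τ ⁻¹' {u : ↥U | ((u : GL n E) : Matrix n n E).charpoly.Separable}) ∩ W₁) ∩ (W₃ ∩ W₄))
    (inter_mem (inter_mem (inter_mem hNB hW₂) hW₁) (inter_mem hW₃ hW₄))
  have hKB : K ×ˢ B₁ ⊆ N ∩ e.source := fun p hp => hNAB (mk_mem_prod (hKN hp.1) (hB₁N hp.2).1.1.1)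
  have hregB : ∀ b ∈ B₁, (((τ b : ↥U) : GL n E) : Matrix n n E).charpoly.Separable ∧
      Subgroup.centralizer ({τ b} : Set ↥U) = Subgroup.centralizer ({γ} : Set ↥U) := fun b hb =>
    ⟨(hB₁N hb).1.1.2, centralizer_eq_centralizer_of_charpoly_separable hγ (hB₁N hb).1.1.2 (hcomm b)⟩
  refine ⟨K, B₁, hKc, hKo, haK, hB₁c, hB₁o, hbB, fun p hp => (hKB hp).1, fun p hp => (hKB hp).2, hregB, ?_, ?_⟩
  · -- (SAT)
    intro b hb x hx
    have hsep : ∀ b ∈ B₁, ∀ b' ∈ B₁, ∀ y : ↥U, y * τ b * y⁻¹ = τ b' → y ∈ Subgroup.centralizer ({τ b} : Set ↥U) :=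
      fun b hb b' hb' y hy => hsepW b (hB₁N hb).1.2 b' (hB₁N hb').1.2 (hcomm b) (hcomm b') y hy
    have himg : e '' (K ×ˢ B₁) = (fun p : A × B => s p.1 * τ p.2 * (s p.1)⁻¹) '' (K ×ˢ B₁) :=
      image_congr fun p hp => he p (hKB hp).2
    rw [himg] at hx
    exact mem_mul_of_conj_mem_image_chart (Subgroup.centralizer ({γ} : Set ↥U)) s τ K B₁ (fun b hb => (hregB b hb).2) hsep
      (τ b) ⟨b, hb, rfl⟩ x hx
  · -- (SEP)
    intro b hb b' hb' hconj
    obtain ⟨g, hg⟩ := isConj_iff.1 hconj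
    have hmem : ∀ c : B, ((τ c : ↥U) : GL n E) ∈ Subgroup.centralizer ({(γ : GL n E)} : Set (GL n E)) := fun c => by
      have h := hcomm c
      rw [Subgroup.mem_centralizer_singleton_iff] at h ⊢
      have h' := congrArg (fun g : ↥U => (g : GL n E)) h
      simpa only [Subgroup.coe_mul] using h'
    have key := hW₃₄ (mk_mem_prod (hB₁N hb).2.1 (hB₁N hb').2.2) (hmem b) (hmem b') g hg
    have hτbb : τ b = τ b' := Subtype.ext key.1.symm
    have h1 : (a₀, b) ∈ e.source := (hKB (mk_mem_prod haK hb)).2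
    have h2 : (a₀, b') ∈ e.source := (hKB (mk_mem_prod haK hb')).2
    have h12 : e (a₀, b) = e (a₀, b') := by rw [he _ h1, he _ h2, hτbb]
    exact congrArg Prod.snd (e.injOn h1 h2 h12)

end Subgroup

/-! ## §2 The Cayley chart of `U(σ, J)` as an `OpenPartialHomeomorph (A × B) U` -/

section Unitary

variable {E : Type*} [NontriviallyNormedField E] [CompleteSpace E] {n : Type*} [Fintype n] [DecidableEq n]

/-- **The Cayley chart as a `U`-valued open partial homeomorphism.** For `γ ∈ U = U(σ, J)` regular semisimple there are TOTAL continuous maps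
`s : A → U`, `τ : B → U` on the θ-skew unit balls `A ⊆ [γ, M]`, `B ⊆ C(γ)` with `s(X) = c(X)`, `τ(Y) = γ c(Y) ∈ Z_U(γ)`, base points `a₀ = 0`, `b₀ = 0`
(`s a₀ = 1`, `τ b₀ = γ`), and an `OpenPartialHomeomorph e : A × B → U` with `(a₀, b₀) ∈ e.source` whose forward map IS `(a, b) ↦ s(a) τ(b) s(a)⁻¹`
(A-p16 (g25)'s matrix-valued chart ★ `exists_openPartialHomeomorph_cayleyConj_isImage_unitary` restricted along its `IsImage {θ-skew} {unitary}`).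
[cite: Weyl1939, Ch. II §10] [cite: HarishChandra1970, Part I §3] -/
theorem exists_openPartialHomeomorph_unitary_cayleyChart [CharZero E] (σ : E →+* E) (hσ : Continuous σ) {J : Matrix n n E}
    (hJ : IsUnit J.det) (γ : ↥(unitaryGroupOfForm σ J)) (hγ : ((γ : GL n E) : Matrix n n E).charpoly.Separable) :
    ∃ (s : ↥{X : Matrix n n E | X ∈ LinearMap.range (LinearMap.mulLeft E ((γ : GL n E) : Matrix n n E) -
            LinearMap.mulRight E ((γ : GL n E) : Matrix n n E)) ∧ J⁻¹ * (X.map σ)ᵀ * J = -X ∧ ‖X‖ < 1} → ↥(unitaryGroupOfForm σ J))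
      (τ : ↥{Y : Matrix n n E | Y ∈ LinearMap.ker (LinearMap.mulLeft E ((γ : GL n E) : Matrix n n E) -
            LinearMap.mulRight E ((γ : GL n E) : Matrix n n E)) ∧ J⁻¹ * (Y.map σ)ᵀ * J = -Y ∧ ‖Y‖ < 1} → ↥(unitaryGroupOfForm σ J))
      (e : OpenPartialHomeomorph
        (↥{X : Matrix n n E | X ∈ LinearMap.range (LinearMap.mulLeft E ((γ : GL n E) : Matrix n n E) -
            LinearMap.mulRight E ((γ : GL n E) : Matrix n n E)) ∧ J⁻¹ * (X.map σ)ᵀ * J = -X ∧ ‖X‖ < 1} ×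
          ↥{Y : Matrix n n E | Y ∈ LinearMap.ker (LinearMap.mulLeft E ((γ : GL n E) : Matrix n n E) -
            LinearMap.mulRight E ((γ : GL n E) : Matrix n n E)) ∧ J⁻¹ * (Y.map σ)ᵀ * J = -Y ∧ ‖Y‖ < 1})
        ↥(unitaryGroupOfForm σ J))
      (a₀ : ↥{X : Matrix n n E | X ∈ LinearMap.range (LinearMap.mulLeft E ((γ : GL n E) : Matrix n n E) -
            LinearMap.mulRight E ((γ : GL n E) : Matrix n n E)) ∧ J⁻¹ * (X.map σ)ᵀ * J = -X ∧ ‖X‖ < 1})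
      (b₀ : ↥{Y : Matrix n n E | Y ∈ LinearMap.ker (LinearMap.mulLeft E ((γ : GL n E) : Matrix n n E) -
            LinearMap.mulRight E ((γ : GL n E) : Matrix n n E)) ∧ J⁻¹ * (Y.map σ)ᵀ * J = -Y ∧ ‖Y‖ < 1}),
      (∀ a, (((s a : ↥(unitaryGroupOfForm σ J)) : GL n E) : Matrix n n E) = cayley (a : Matrix n n E)) ∧
      (∀ b, (((τ b : ↥(unitaryGroupOfForm σ J)) : GL n E) : Matrix n n E) = ((γ : GL n E) : Matrix n n E) * cayley (b : Matrix n n E)) ∧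
      Continuous s ∧ Continuous τ ∧ (a₀ : Matrix n n E) = 0 ∧ (b₀ : Matrix n n E) = 0 ∧ s a₀ = 1 ∧ τ b₀ = γ ∧
      (∀ b, τ b ∈ Subgroup.centralizer ({γ} : Set ↥(unitaryGroupOfForm σ J))) ∧
      (a₀, b₀) ∈ e.source ∧ ∀ p, e p = s p.1 * τ p.2 * (s p.1)⁻¹ := by
  classical
  haveI : CompleteSpace (Matrix n n E) := FiniteDimensional.complete E (Matrix n n E)
  haveI : HasSummableGeomSeries (Matrix n n E) :=
    @instHasSummableGeomSeriesOfCompleteSpace (Matrix n n E) _ (FiniteDimensional.complete E (Matrix n n E))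
  obtain ⟨e₃, h0, -, he₃, -, hIm⟩ := exists_openPartialHomeomorph_cayleyConj_isImage_unitary σ hσ hJ (γ : GL n E) γ.2 hγ
  -- `1 ± X` are units inside the unit ball
  have h1S : ∀ {X : Matrix n n E}, ‖X‖ < 1 → IsUnit (1 + X) := fun {X} h => by
    have hu := (Units.oneSub (-X) (by rwa [norm_neg])).isUnit
    rwa [Units.val_oneSub, sub_neg_eq_add] at hu
  have h2S : ∀ {X : Matrix n n E}, ‖X‖ < 1 → IsUnit (1 - X) := fun {X} h => by
    have hu := (Units.oneSub X h).isUnit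
    rwa [Units.val_oneSub] at hu
  -- the carriers
  set SA : Set (Matrix n n E) := {X | X ∈ LinearMap.range (LinearMap.mulLeft E ((γ : GL n E) : Matrix n n E) -
      LinearMap.mulRight E ((γ : GL n E) : Matrix n n E)) ∧ J⁻¹ * (X.map σ)ᵀ * J = -X ∧ ‖X‖ < 1} with hSA
  set SB : Set (Matrix n n E) := {Y | Y ∈ LinearMap.ker (LinearMap.mulLeft E ((γ : GL n E) : Matrix n n E) -
      LinearMap.mulRight E ((γ : GL n E) : Matrix n n E)) ∧ J⁻¹ * (Y.map σ)ᵀ * J = -Y ∧ ‖Y‖ < 1} with hSB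
  have hSA1 : ∀ X ∈ SA, ‖X‖ < 1 := fun X hX => hX.2.2
  have hSB1 : ∀ Y ∈ SB, ‖Y‖ < 1 := fun Y hY => hY.2.2
  have hcU : ∀ {X : Matrix n n E}, J⁻¹ * (X.map σ)ᵀ * J = -X → (hp : IsUnit (1 + X)) → (hq : IsUnit (1 - X)) →
      (isUnit_cayley hp hq).unit ∈ unitaryGroupOfForm σ J := fun {X} hX hp hq => by
    obtain ⟨g, hg, hgc⟩ := cayley_mem_unitaryGroupOfForm (σ := σ) hJ hX hp hq
    have hge : (isUnit_cayley hp hq).unit = g := Units.ext (by rw [IsUnit.unit_spec, hgc])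
    rw [hge]
    exact hg
  -- the chart datum `s`, `τ`
  let s : ↥SA → ↥(unitaryGroupOfForm σ J) := fun a =>
    ⟨(isUnit_cayley (h1S (hSA1 a a.2)) (h2S (hSA1 a a.2))).unit, hcU a.2.2.1 (h1S (hSA1 a a.2)) (h2S (hSA1 a a.2))⟩
  let cB : ↥SB → ↥(unitaryGroupOfForm σ J) := fun b =>
    ⟨(isUnit_cayley (h1S (hSB1 b b.2)) (h2S (hSB1 b b.2))).unit, hcU b.2.2.1 (h1S (hSB1 b b.2)) (h2S (hSB1 b b.2))⟩
  let τ : ↥SB → ↥(unitaryGroupOfForm σ J) := fun b => γ * cB b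
  have hsval : ∀ a : ↥SA, (((s a : ↥(unitaryGroupOfForm σ J)) : GL n E) : Matrix n n E) = cayley (a : Matrix n n E) := fun a => rfl
  have hτval : ∀ b : ↥SB, (((τ b : ↥(unitaryGroupOfForm σ J)) : GL n E) : Matrix n n E) =
      ((γ : GL n E) : Matrix n n E) * cayley (b : Matrix n n E) := fun b => rfl
  have hs : Continuous s :=
    (continuous_cayleyUnit (S := SA) (fun a => h1S (hSA1 a a.2)) (fun a => h2S (hSA1 a a.2))).subtype_mk _
  have hτ : Continuous τ :=
    continuous_const.mul ((continuous_cayleyUnit (S := SB) (fun b => h1S (hSB1 b b.2)) (fun b => h2S (hSB1 b b.2))).subtype_mk _)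
  -- base points
  have hθ0 : J⁻¹ * ((0 : Matrix n n E).map σ)ᵀ * J = -0 := by
    rw [Matrix.map_zero σ (map_zero σ), Matrix.transpose_zero, Matrix.mul_zero, Matrix.zero_mul, neg_zero]
  let a₀ : ↥SA := ⟨0, LinearMap.mem_range.2 ⟨0, map_zero _⟩, hθ0, by rw [norm_zero]; exact one_pos⟩
  let b₀ : ↥SB := ⟨0, LinearMap.mem_ker.2 (map_zero _), hθ0, by rw [norm_zero]; exact one_pos⟩
  have hs₀ : s a₀ = 1 := by
    apply Subtype.ext
    apply Units.ext
    rw [hsval a₀, show ((a₀ : ↥SA) : Matrix n n E) = 0 from rfl, cayley_zero]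
    rfl
  have hτ₀ : τ b₀ = γ := by
    apply Subtype.ext
    apply Units.ext
    rw [hτval b₀, show ((b₀ : ↥SB) : Matrix n n E) = 0 from rfl, cayley_zero, mul_one]
  have hcomm : ∀ b : ↥SB, τ b ∈ Subgroup.centralizer ({γ} : Set ↥(unitaryGroupOfForm σ J)) := fun b => by
    have hk : Commute ((γ : GL n E) : Matrix n n E) (b : Matrix n n E) := by
      have h := LinearMap.mem_ker.1 b.2.1
      rw [LinearMap.sub_apply, LinearMap.mulLeft_apply, LinearMap.mulRight_apply, sub_eq_zero] at h
      exact h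
    have hc := commute_cayley hk (h1S (hSB1 b b.2))
    rw [Subgroup.mem_centralizer_singleton_iff]
    apply Subtype.ext
    apply Units.ext
    show (((τ b : ↥(unitaryGroupOfForm σ J)) : GL n E) : Matrix n n E) * ((γ : GL n E) : Matrix n n E) =
      ((γ : GL n E) : Matrix n n E) * (((τ b : ↥(unitaryGroupOfForm σ J)) : GL n E) : Matrix n n E)
    rw [hτval, mul_assoc, ← hc.eq]
  -- the inclusion `ι : A × B → 𝔪 × 𝔠` and the forward map `Φ`
  let ι : ↥SA × ↥SB →
      ↥(LinearMap.range (LinearMap.mulLeft E ((γ : GL n E) : Matrix n n E) - LinearMap.mulRight E ((γ : GL n E) : Matrix n n E))) ×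
        ↥(LinearMap.ker (LinearMap.mulLeft E ((γ : GL n E) : Matrix n n E) - LinearMap.mulRight E ((γ : GL n E) : Matrix n n E))) :=
    fun p => (⟨(p.1 : Matrix n n E), p.1.2.1⟩, ⟨(p.2 : Matrix n n E), p.2.2.1⟩)
  have hι : Continuous ι :=
    ((continuous_subtype_val.comp continuous_fst).subtype_mk _).prodMk ((continuous_subtype_val.comp continuous_snd).subtype_mk _)
  let Φ : ↥SA × ↥SB → ↥(unitaryGroupOfForm σ J) := fun p => s p.1 * τ p.2 * (s p.1)⁻¹
  have hΦc : Continuous Φ := ((hs.comp continuous_fst).mul (hτ.comp continuous_snd)).mul ((hs.comp continuous_fst).inv)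
  have hΦval : ∀ p, (((Φ p : ↥(unitaryGroupOfForm σ J)) : GL n E) : Matrix n n E) = e₃ (ι p) := fun p => by
    rw [he₃]
    show (((s p.1 : ↥(unitaryGroupOfForm σ J)) : GL n E) : Matrix n n E) * (((τ p.2 : ↥(unitaryGroupOfForm σ J)) : GL n E) : Matrix n n E) *
        ((((s p.1 : ↥(unitaryGroupOfForm σ J)))⁻¹ : GL n E) : Matrix n n E) =
      cayley (p.1 : Matrix n n E) * (((γ : GL n E) : Matrix n n E) * cayley (p.2 : Matrix n n E)) * Ring.inverse (cayley (p.1 : Matrix n n E))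
    rw [hτval, ← Ring.inverse_unit]
    rfl
  -- the backward projections (total; the identity on the carriers)
  let prA : Matrix n n E → ↥SA := fun X => if h : X ∈ SA then ⟨X, h⟩ else a₀
  let prB : Matrix n n E → ↥SB := fun Y => if h : Y ∈ SB then ⟨Y, h⟩ else b₀
  have hprA : ContinuousOn prA SA := by
    rw [continuousOn_iff_continuous_restrict]
    have h : SA.restrict prA = id := funext fun x => by
      show prA (x : Matrix n n E) = x
      simp only [prA, dif_pos x.2]
    rw [h]
    exact continuous_id
  have hprB : ContinuousOn prB SB := by
    rw [continuousOn_iff_continuous_restrict]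
    have h : SB.restrict prB = id := funext fun x => by
      show prB (x : Matrix n n E) = x
      simp only [prB, dif_pos x.2]
    rw [h]
    exact continuous_id
  -- what the image condition gives on the target side
  have hback : ∀ u : ↥(unitaryGroupOfForm σ J), ((u : GL n E) : Matrix n n E) ∈ e₃.target →
      ‖((e₃.symm ((u : GL n E) : Matrix n n E)).1 : Matrix n n E)‖ < 1 → ‖((e₃.symm ((u : GL n E) : Matrix n n E)).2 : Matrix n n E)‖ < 1 →
      ((e₃.symm ((u : GL n E) : Matrix n n E)).1 : Matrix n n E) ∈ SA ∧ ((e₃.symm ((u : GL n E) : Matrix n n E)).2 : Matrix n n E) ∈ SB := by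
    intro u hu h1 h2
    have hsrc : e₃.symm ((u : GL n E) : Matrix n n E) ∈ e₃.source := e₃.map_target hu
    have hval : e₃ (e₃.symm ((u : GL n E) : Matrix n n E)) = ((u : GL n E) : Matrix n n E) := e₃.right_inv hu
    have hT : e₃ (e₃.symm ((u : GL n E) : Matrix n n E)) ∈ {W : Matrix n n E | ∃ g ∈ unitaryGroupOfForm σ J, (g : Matrix n n E) = W} :=
      ⟨(u : GL n E), u.2, hval.symm⟩
    have hθ := (hIm hsrc).1 hT
    exact ⟨⟨(e₃.symm ((u : GL n E) : Matrix n n E)).1.2, hθ.1, h1⟩, ⟨(e₃.symm ((u : GL n E) : Matrix n n E)).2.2, hθ.2, h2⟩⟩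
  -- the open partial homeomorphism
  have hcoe : Continuous fun u : ↥(unitaryGroupOfForm σ J) => ((u : GL n E) : Matrix n n E) :=
    Units.continuous_val.comp continuous_subtype_val
  refine ⟨s, τ,
    { toFun := Φ
      invFun := fun u => (prA ((e₃.symm ((u : GL n E) : Matrix n n E)).1 : Matrix n n E), prB ((e₃.symm ((u : GL n E) : Matrix n n E)).2 : Matrix n n E))
      source := ι ⁻¹' e₃.source
      target := (fun u : ↥(unitaryGroupOfForm σ J) => ((u : GL n E) : Matrix n n E)) ⁻¹'
        (e₃.target ∩ e₃.symm ⁻¹' {x | ‖(x.1 : Matrix n n E)‖ < 1 ∧ ‖(x.2 : Matrix n n E)‖ < 1})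
      map_source' := ?_
      map_target' := ?_
      left_inv' := ?_
      right_inv' := ?_
      open_source := e₃.open_source.preimage hι
      open_target := (e₃.isOpen_inter_preimage_symm
        ((isOpen_lt (continuous_norm.comp (continuous_subtype_val.comp continuous_fst)) continuous_const).inter
          (isOpen_lt (continuous_norm.comp (continuous_subtype_val.comp continuous_snd)) continuous_const))).preimage hcoe
      continuousOn_toFun := hΦc.continuousOn
      continuousOn_invFun := ?_ }, a₀, b₀, hsval, hτval, hs, hτ, rfl, rfl, hs₀, hτ₀, hcomm, ?_, fun p => rfl⟩
  · -- map_source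
    intro p hp
    have hp' : ι p ∈ e₃.source := hp
    refine ⟨?_, ?_⟩
    · show (((Φ p : ↥(unitaryGroupOfForm σ J)) : GL n E) : Matrix n n E) ∈ e₃.target
      rw [hΦval]
      exact e₃.map_source hp'
    · show e₃.symm (((Φ p : ↥(unitaryGroupOfForm σ J)) : GL n E) : Matrix n n E) ∈ {x :
          ↥(LinearMap.range (LinearMap.mulLeft E ((γ : GL n E) : Matrix n n E) - LinearMap.mulRight E ((γ : GL n E) : Matrix n n E))) ×
          ↥(LinearMap.ker (LinearMap.mulLeft E ((γ : GL n E) : Matrix n n E) - LinearMap.mulRight E ((γ : GL n E) : Matrix n n E))) |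
          ‖(x.1 : Matrix n n E)‖ < 1 ∧ ‖(x.2 : Matrix n n E)‖ < 1}
      rw [hΦval, e₃.left_inv hp']
      exact ⟨p.1.2.2.2, p.2.2.2.2⟩
  · -- map_target
    intro u hu
    obtain ⟨hA, hB⟩ := hback u hu.1 hu.2.1 hu.2.2
    show ι (prA ((e₃.symm ((u : GL n E) : Matrix n n E)).1 : Matrix n n E), prB ((e₃.symm ((u : GL n E) : Matrix n n E)).2 : Matrix n n E)) ∈ e₃.source
    have h1 : ι (prA ((e₃.symm ((u : GL n E) : Matrix n n E)).1 : Matrix n n E), prB ((e₃.symm ((u : GL n E) : Matrix n n E)).2 : Matrix n n E)) =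
        e₃.symm ((u : GL n E) : Matrix n n E) := by
      simp only [ι, prA, prB, dif_pos hA, dif_pos hB]
    rw [h1]
    exact e₃.map_target hu.1
  · -- left_inv
    intro p hp
    have hp' : ι p ∈ e₃.source := hp
    have h1 : e₃.symm (((Φ p : ↥(unitaryGroupOfForm σ J)) : GL n E) : Matrix n n E) = ι p := by rw [hΦval, e₃.left_inv hp']
    show (prA ((e₃.symm (((Φ p : ↥(unitaryGroupOfForm σ J)) : GL n E) : Matrix n n E)).1 : Matrix n n E),
        prB ((e₃.symm (((Φ p : ↥(unitaryGroupOfForm σ J)) : GL n E) : Matrix n n E)).2 : Matrix n n E)) = p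
    rw [h1]
    exact Prod.ext (by simp only [ι, prA, dif_pos p.1.2]) (by simp only [ι, prB, dif_pos p.2.2])
  · -- right_inv
    intro u hu
    obtain ⟨hA, hB⟩ := hback u hu.1 hu.2.1 hu.2.2
    apply Subtype.ext
    apply Units.ext
    show (((Φ (prA ((e₃.symm ((u : GL n E) : Matrix n n E)).1 : Matrix n n E), prB ((e₃.symm ((u : GL n E) : Matrix n n E)).2 : Matrix n n E)) :
        ↥(unitaryGroupOfForm σ J)) : GL n E) : Matrix n n E) = ((u : GL n E) : Matrix n n E)
    rw [hΦval]
    have h1 : ι (prA ((e₃.symm ((u : GL n E) : Matrix n n E)).1 : Matrix n n E), prB ((e₃.symm ((u : GL n E) : Matrix n n E)).2 : Matrix n n E)) =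
        e₃.symm ((u : GL n E) : Matrix n n E) := by
      simp only [ι, prA, prB, dif_pos hA, dif_pos hB]
    rw [h1]
    exact e₃.right_inv hu.1
  · -- continuity of the inverse on the target
    have hsymm : ContinuousOn (fun u : ↥(unitaryGroupOfForm σ J) => e₃.symm ((u : GL n E) : Matrix n n E))
        ((fun u : ↥(unitaryGroupOfForm σ J) => ((u : GL n E) : Matrix n n E)) ⁻¹'
          (e₃.target ∩ e₃.symm ⁻¹' {x | ‖(x.1 : Matrix n n E)‖ < 1 ∧ ‖(x.2 : Matrix n n E)‖ < 1})) :=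
      e₃.continuousOn_symm.comp hcoe.continuousOn fun u hu => hu.1
    refine ContinuousOn.prodMk ?_ ?_
    · exact hprA.comp ((continuous_subtype_val.comp continuous_fst).comp_continuousOn hsymm) fun u hu => (hback u hu.1 hu.2.1 hu.2.2).1
    · exact hprB.comp ((continuous_subtype_val.comp continuous_snd).comp_continuousOn hsymm) fun u hu => (hback u hu.1 hu.2.1 hu.2.2).2
  · -- `(a₀, b₀) ∈ e.source`
    show ι (a₀, b₀) ∈ e₃.source
    have h1 : ι (a₀, b₀) = 0 := Prod.ext (Subtype.ext rfl) (Subtype.ext rfl)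
    rw [h1]
    exact h0

end Unitary

/-! ## §3 Compact-open neighbourhood bases of the carriers at `0` (`E` proper and totally disconnected) -/

section Boxes

variable {E : Type*} [NontriviallyNormedField E] {n : Type*} [Fintype n] [DecidableEq n]

/-- **The θ-skew unit ball of a subspace has a compact-open neighbourhood basis at `0`** when `E` is proper and totally disconnected (the
non-archimedean local fields): `M_n(E)` is locally compact, Hausdorff and totally disconnected, so it has a clopen basis (Mathlib
`loc_compact_Haus_tot_disc_of_zero_dim`); a compact open `V ∋ 0` inside the open unit ball meets the carrier in `V ∩ (C ∩ {θ-skew})`, compact because the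
θ-skew part of the subspace `C` is closed. [cite: Weyl1939, Ch. II §10] -/
theorem exists_isCompact_isOpen_nhds_skewBall [ProperSpace E] [TotallyDisconnectedSpace E] (σ : E →+* E) (hσ : Continuous σ)
    (J : Matrix n n E) (C : Submodule E (Matrix n n E))
    (x₀ : ↥{X : Matrix n n E | X ∈ C ∧ J⁻¹ * (X.map σ)ᵀ * J = -X ∧ ‖X‖ < 1}) (hx₀ : (x₀ : Matrix n n E) = 0) :
    ∀ N ∈ 𝓝 x₀, ∃ K : Set ↥{X : Matrix n n E | X ∈ C ∧ J⁻¹ * (X.map σ)ᵀ * J = -X ∧ ‖X‖ < 1},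
      IsCompact K ∧ IsOpen K ∧ x₀ ∈ K ∧ K ⊆ N := by
  intro N hN
  haveI : LocallyCompactSpace (Matrix n n E) := inferInstanceAs (LocallyCompactSpace (n → n → E))
  haveI : TotallyDisconnectedSpace (Matrix n n E) := inferInstanceAs (TotallyDisconnectedSpace (n → n → E))
  obtain ⟨V₁, hV₁, hV₁N⟩ := (mem_nhds_subtype _ x₀ N).1 hN
  have hball : Metric.ball (0 : Matrix n n E) 1 ∈ 𝓝 (x₀ : Matrix n n E) := by
    rw [hx₀]
    exact Metric.isOpen_ball.mem_nhds (Metric.mem_ball_self one_pos)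
  obtain ⟨V, hVc, hVo, hxV, hVsub⟩ := exists_isCompact_isOpen_mem_subset_of_mem_nhds (inter_mem hV₁ hball)
  refine ⟨Subtype.val ⁻¹' V, ?_, hVo.preimage continuous_subtype_val, hxV, fun y hy => hV₁N (hVsub hy).1⟩
  rw [Topology.IsEmbedding.subtypeVal.isCompact_iff, image_preimage_eq_inter_range, Subtype.range_coe]
  have hθ : Continuous fun X : Matrix n n E => J⁻¹ * (X.map σ)ᵀ * J :=
    (continuous_const.mul ((continuous_id.matrix_map hσ).matrix_transpose)).mul continuous_const
  have hcl : IsClosed {X : Matrix n n E | X ∈ C ∧ J⁻¹ * (X.map σ)ᵀ * J = -X} :=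
    IsClosed.inter C.closed_of_finiteDimensional (isClosed_eq hθ continuous_neg)
  have heq : V ∩ {X : Matrix n n E | X ∈ C ∧ J⁻¹ * (X.map σ)ᵀ * J = -X ∧ ‖X‖ < 1} =
      V ∩ {X : Matrix n n E | X ∈ C ∧ J⁻¹ * (X.map σ)ᵀ * J = -X} := by
    ext X
    constructor
    · rintro ⟨hV, hC, hX, -⟩
      exact ⟨hV, hC, hX⟩
    · rintro ⟨hV, hC, hX⟩
      have h1 := (hVsub hV).2
      rw [Metric.mem_ball, dist_zero_right] at h1
      exact ⟨hV, hC, hX, h1⟩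
  rw [heq]
  exact hVc.inter_right hcl

end Boxes

/-! ## §4 The assembled head: the unitary Cayley chart datum with its regular, saturated, stably separated boxes -/

section Head

variable {E : Type*} [NontriviallyNormedField E] [CompleteSpace E] {n : Type*} [Fintype n] [DecidableEq n]

/-- **N6ns-reg-(iv) CM DRESS, FIELD LEVEL — THE UNITARY CAYLEY CHART DATUM.** `E` a complete, proper, totally disconnected non-trivially normed field of
characteristic zero, `σ` continuous, `J` with unit determinant, `γ ∈ U = U(σ, J)` regular semisimple. There are total continuous `s : A → U` (`s(X) = c(X)`),
`τ : B → U` (`τ(Y) = γ c(Y) ∈ Z_U(γ)`) on the θ-skew unit balls `A ⊆ [γ, M]`, `B ⊆ C(γ)`, base points `a₀ = 0`, `b₀ = 0` (`s a₀ = 1`, `τ b₀ = γ`) and an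
`OpenPartialHomeomorph e : A × B → U`, `(a₀, b₀) ∈ e.source`, `e(a, b) = s(a) τ(b) s(a)⁻¹` EVERYWHERE, such that EVERY neighbourhood of `(a₀, b₀)` contains a
compact-open box `K × B₁ ⊆ e.source` (`a₀ ∈ K`, `b₀ ∈ B₁`) with: (reg) `χ(τ b)` separable and `Z_U(τ b) = Z_U(γ)`; (SAT) `x τ(b) x⁻¹ ∈ e(K × B₁) ⇒ x ∈ s(K)·Z_U(γ)`;
(SEP) `τ b ∼_{GL_n(E)} τ b′ ⇒ b = b′` (stable conjugacy separates the box — the input of the realisation layer's (iv-c), ★ `Rogawski1990.isStablyConj_iff`).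
These are the binders `e s hs τ he hKB hreg hsat` of ★ `OrbitalMeasureFamily.IsCanonical.exists_isLocSmooth_classOrbitalIntegral_mk_eq_of_chart` for a unitary
group. [cite: HarishChandra1970, Part I §3] [cite: Rogawski1990, §3.1 p. 19; §4.3 p. 43; §4.9 p. 54] [cite: Weyl1939, Ch. II §10] -/
theorem exists_unitary_cayleyChartDatum [CharZero E] [ProperSpace E] [TotallyDisconnectedSpace E] (σ : E →+* E) (hσ : Continuous σ)
    {J : Matrix n n E} (hJ : IsUnit J.det) (γ : ↥(unitaryGroupOfForm σ J)) (hγ : ((γ : GL n E) : Matrix n n E).charpoly.Separable) :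
    ∃ (s : ↥{X : Matrix n n E | X ∈ LinearMap.range (LinearMap.mulLeft E ((γ : GL n E) : Matrix n n E) -
            LinearMap.mulRight E ((γ : GL n E) : Matrix n n E)) ∧ J⁻¹ * (X.map σ)ᵀ * J = -X ∧ ‖X‖ < 1} → ↥(unitaryGroupOfForm σ J))
      (τ : ↥{Y : Matrix n n E | Y ∈ LinearMap.ker (LinearMap.mulLeft E ((γ : GL n E) : Matrix n n E) -
            LinearMap.mulRight E ((γ : GL n E) : Matrix n n E)) ∧ J⁻¹ * (Y.map σ)ᵀ * J = -Y ∧ ‖Y‖ < 1} → ↥(unitaryGroupOfForm σ J))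
      (e : OpenPartialHomeomorph
        (↥{X : Matrix n n E | X ∈ LinearMap.range (LinearMap.mulLeft E ((γ : GL n E) : Matrix n n E) -
            LinearMap.mulRight E ((γ : GL n E) : Matrix n n E)) ∧ J⁻¹ * (X.map σ)ᵀ * J = -X ∧ ‖X‖ < 1} ×
          ↥{Y : Matrix n n E | Y ∈ LinearMap.ker (LinearMap.mulLeft E ((γ : GL n E) : Matrix n n E) -
            LinearMap.mulRight E ((γ : GL n E) : Matrix n n E)) ∧ J⁻¹ * (Y.map σ)ᵀ * J = -Y ∧ ‖Y‖ < 1})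
        ↥(unitaryGroupOfForm σ J))
      (a₀ : ↥{X : Matrix n n E | X ∈ LinearMap.range (LinearMap.mulLeft E ((γ : GL n E) : Matrix n n E) -
            LinearMap.mulRight E ((γ : GL n E) : Matrix n n E)) ∧ J⁻¹ * (X.map σ)ᵀ * J = -X ∧ ‖X‖ < 1})
      (b₀ : ↥{Y : Matrix n n E | Y ∈ LinearMap.ker (LinearMap.mulLeft E ((γ : GL n E) : Matrix n n E) -
            LinearMap.mulRight E ((γ : GL n E) : Matrix n n E)) ∧ J⁻¹ * (Y.map σ)ᵀ * J = -Y ∧ ‖Y‖ < 1}),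
      (∀ a, (((s a : ↥(unitaryGroupOfForm σ J)) : GL n E) : Matrix n n E) = cayley (a : Matrix n n E)) ∧
      (∀ b, (((τ b : ↥(unitaryGroupOfForm σ J)) : GL n E) : Matrix n n E) = ((γ : GL n E) : Matrix n n E) * cayley (b : Matrix n n E)) ∧
      Continuous s ∧ Continuous τ ∧ (a₀ : Matrix n n E) = 0 ∧ (b₀ : Matrix n n E) = 0 ∧ s a₀ = 1 ∧ τ b₀ = γ ∧
      (∀ b, τ b ∈ Subgroup.centralizer ({γ} : Set ↥(unitaryGroupOfForm σ J))) ∧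
      (a₀, b₀) ∈ e.source ∧ (∀ p, e p = s p.1 * τ p.2 * (s p.1)⁻¹) ∧
      ∀ N ∈ 𝓝 (a₀, b₀), ∃ (K : Set ↥{X : Matrix n n E | X ∈ LinearMap.range (LinearMap.mulLeft E ((γ : GL n E) : Matrix n n E) -
            LinearMap.mulRight E ((γ : GL n E) : Matrix n n E)) ∧ J⁻¹ * (X.map σ)ᵀ * J = -X ∧ ‖X‖ < 1})
          (B₁ : Set ↥{Y : Matrix n n E | Y ∈ LinearMap.ker (LinearMap.mulLeft E ((γ : GL n E) : Matrix n n E) -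
            LinearMap.mulRight E ((γ : GL n E) : Matrix n n E)) ∧ J⁻¹ * (Y.map σ)ᵀ * J = -Y ∧ ‖Y‖ < 1}),
        IsCompact K ∧ IsOpen K ∧ a₀ ∈ K ∧ IsCompact B₁ ∧ IsOpen B₁ ∧ b₀ ∈ B₁ ∧ K ×ˢ B₁ ⊆ N ∧ K ×ˢ B₁ ⊆ e.source ∧
        (∀ b ∈ B₁, (((τ b : ↥(unitaryGroupOfForm σ J)) : GL n E) : Matrix n n E).charpoly.Separable ∧
          Subgroup.centralizer ({τ b} : Set ↥(unitaryGroupOfForm σ J)) = Subgroup.centralizer ({γ} : Set ↥(unitaryGroupOfForm σ J))) ∧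
        (∀ b ∈ B₁, ∀ x : ↥(unitaryGroupOfForm σ J), x * τ b * x⁻¹ ∈ e '' (K ×ˢ B₁) →
          x ∈ s '' K * (Subgroup.centralizer ({γ} : Set ↥(unitaryGroupOfForm σ J)) : Set ↥(unitaryGroupOfForm σ J))) ∧
        (∀ b ∈ B₁, ∀ b' ∈ B₁, IsConj ((τ b : ↥(unitaryGroupOfForm σ J)) : GL n E) ((τ b' : ↥(unitaryGroupOfForm σ J)) : GL n E) → b = b') := by
  obtain ⟨s, τ, e, a₀, b₀, hsval, hτval, hs, hτ, ha₀, hb₀, hs₀, hτ₀, hcomm, h₀, he⟩ :=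
    exists_openPartialHomeomorph_unitary_cayleyChart σ hσ hJ γ hγ
  refine ⟨s, τ, e, a₀, b₀, hsval, hτval, hs, hτ, ha₀, hb₀, hs₀, hτ₀, hcomm, h₀, he, ?_⟩
  exact exists_box_of_chartDatum hγ s τ hτ e (fun p _ => he p) h₀ hτ₀ hcomm
    (exists_isCompact_isOpen_nhds_skewBall σ hσ J _ a₀ ha₀) (exists_isCompact_isOpen_nhds_skewBall σ hσ J _ b₀ hb₀)

end Head

end Literature.NumberTheory.Automorphic

end
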